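import Summits.AtomisticToContinuum.BoseEinsteinCondensation.Theorems.BECCutLineWeakDisorderGroundStateRigidityStubEnergyTruncAux
import Literature.MathematicalPhysics.QuantumManyBody.BoseGasHardCoreContact
import HarnessLib

/-!
# Crux `GroundStateRigidity` (stmt-AtomisticToContinuum-9072), line `Sketch`:
# stub `stub_cutStateBound` (Stub 15f: form, mass and `L²`-distance bounds for the core-cut state)

Supports (does not close) stmt-AtomisticToContinuum-9072; registered stub `stub_cutStateBound` of
line Sketch (lead c3). For the hard-core class (`v = ⊤` on `[0,b]`, `v ≤ C` beyond `b`, `m ≥ C`), a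
trial state `Φ` and an outer `C¹` cutoff `χ ∈ [0,1]` (`χ = 0` where some pair is `≤ b`, `χ = 1`
where all pairs are `≥ b + 3s`, `|∇χ|² ≤ A'` and supported where some pair is in `(b, b + 3s)`),
the cut state `χΦ` satisfies: (i) the form bound `Q_v(χΦ) ≤ (1+θ) 𝓔_{v ⊓ m}[Φ] +
(1+θ⁻¹) A' ∑_{i ≠ j} ∫_{shell_{ij}} |Φ|²` (IMS/Young multiplier bound
`kineticDensity_ofReal_mul_le`; on `supp χ` the full and truncated interactions agree); (ii) the
mass bound `1 ≤ ∫|χΦ|² + ∫_{some pair ≤ b} |Φ|² + ∑_{i ≠ j} ∫_{shell_{ij}} |Φ|²`; (iii) the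
distance bound `∫|χΦ − Φ|² ≤ ∫_{some pair ≤ b} |Φ|² + ∑_{i ≠ j} ∫_{shell_{ij}} |Φ|²` (where `χ ≠ 1`
some pair is `< b + 3s`). Helpers in namespace `GroundStateRigidity.CutState`.
-/

noncomputable section

open MeasureTheory Filter Set Metric
open scoped ENNReal NNReal Topology

namespace Summit.AtomisticToContinuum.BoseEinsteinCondensation.Theorems.GroundStateRigidity

open Literature.MathematicalPhysics.QuantumManyBody.BoseGas

namespace CutState

variable {N : ℕ} {L : ℝ}

/-! ### Combinatorial covering facts -/

/-- If the pair `(i, j)` of `X` lies in the shell, then `F X` is dominated by the double shell sum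
`∑_{i'} ∑_{j' ≠ i'} 1_{shell_{i'j'}} F`. [folklore] -/
theorem le_sum_shell {a δ : ℝ} (F : Config N → ℝ≥0∞) {X : Config N} {i j : Fin N} (hij : i ≠ j)
    (hX : X ∈ shellPair a δ i j) :
    F X ≤ ∑ i' : Fin N, ∑ j' ∈ Finset.univ.erase i', (shellPair a δ i' j').indicator F X := by
  calc F X = (shellPair a δ i j).indicator F X := (indicator_of_mem hX F).symm
    _ ≤ ∑ j' ∈ Finset.univ.erase i, (shellPair a δ i j').indicator F X :=
        Finset.single_le_sum (f := fun j' => (shellPair a δ i j').indicator F X)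
          (fun _ _ => zero_le) (Finset.mem_erase.2 ⟨hij.symm, Finset.mem_univ j⟩)
    _ ≤ _ := Finset.single_le_sum
          (f := fun i' => ∑ j' ∈ Finset.univ.erase i', (shellPair a δ i' j').indicator F X)
          (fun _ _ => zero_le) (Finset.mem_univ i)

/-- **Covering of `{χ ≠ 1}`.** If `χ = 1` wherever all pairs are `≥ b + 3s` apart, then at a point
with `χ X ≠ 1` some pair is either `≤ b` (core) or in the shell `(b, b + 3s)`, so
`F X ≤ 1_{core} F X + ∑_{i} ∑_{j ≠ i} 1_{shell_{ij}} F X`. [folklore] -/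
theorem cover_pt {b s : ℝ} {χ : Config N → ℝ}
    (hχ1 : ∀ X : Config N, (∀ i j : Fin N, i ≠ j → b + 3 * s ≤ dist (X i) (X j)) → χ X = 1)
    (F : Config N → ℝ≥0∞) {X : Config N} (hX : χ X ≠ 1) :
    F X ≤ {Y : Config N | ∃ i j : Fin N, i ≠ j ∧ dist (Y i) (Y j) ≤ b}.indicator F X +
      ∑ i : Fin N, ∑ j ∈ Finset.univ.erase i, (shellPair b (3 * s) i j).indicator F X := by
  obtain ⟨i, j, hij, hlt⟩ : ∃ i j : Fin N, i ≠ j ∧ dist (X i) (X j) < b + 3 * s := by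
    by_contra h
    push Not at h
    exact hX (hχ1 X h)
  rcases le_or_gt (dist (X i) (X j)) b with hle | hbl
  · have hK : X ∈ {Y : Config N | ∃ i j : Fin N, i ≠ j ∧ dist (Y i) (Y j) ≤ b} :=
      ⟨i, j, hij, hle⟩
    rw [indicator_of_mem hK]
    exact le_self_add
  · exact (le_sum_shell F hij ⟨hbl, hlt⟩).trans le_add_self

/-- Beyond the core the truncated interaction is the full one: if all pairs are at distance `> b`,
`v ≤ C` on `(b, ∞)` and `C ≤ m`, then `∑ v = ∑ min(v, m)`. [folklore] -/
theorem interaction_eq_trunc_of_lt {v : ℝ → ℝ≥0∞} {b : ℝ} {C : ℝ≥0} {m : ℕ}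
    (hC : ∀ t : ℝ, b < t → v t ≤ C) (hm : (C : ℝ≥0∞) ≤ m) {X : Config N}
    (hfar : ∀ i j : Fin N, i ≠ j → b < dist (X i) (X j)) :
    interaction v X = interaction (fun r => min (v r) (m : ℝ≥0∞)) X := by
  -- adapted from `GroundStateRigidity.EnergyTrunc.interaction_eq_trunc`
  unfold interaction
  refine Finset.sum_congr rfl fun i _ => Finset.sum_congr rfl fun j hj => ?_
  have hij : i ≠ j := (Finset.mem_filter.1 hj).2.ne
  exact (min_eq_left ((hC _ (hfar i j hij)).trans hm)).symm

/-! ### Measurability and the shell sums -/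

/-- The shell-restricted density `1_{shell_{ij}} |Φ|²` is measurable. [folklore] -/
theorem measurable_shell_indicator (Φ : TrialState N L) (a δ : ℝ) (i j : Fin N) :
    Measurable ((shellPair a δ i j).indicator fun Y => (‖Φ.ψ Y‖₊ : ℝ≥0∞) ^ 2) :=
  (measurable_normSq Φ.contDiff.continuous).indicator (measurableSet_shellPair a δ i j)

/-- The double shell sum `∑_{i} ∑_{j ≠ i} 1_{shell_{ij}} |Φ|²` is measurable. [folklore] -/
theorem measurable_sum_shell (Φ : TrialState N L) (a δ : ℝ) :
    Measurable fun X : Config N => ∑ i : Fin N, ∑ j ∈ Finset.univ.erase i,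
      (shellPair a δ i j).indicator (fun Y => (‖Φ.ψ Y‖₊ : ℝ≥0∞) ^ 2) X :=
  Finset.measurable_sum _ fun i _ => Finset.measurable_sum _ fun j _ =>
    measurable_shell_indicator Φ a δ i j

/-- Integrating the double shell sum termwise. [folklore] -/
theorem lintegral_sum_shell (Φ : TrialState N L) (a δ : ℝ) :
    ∫⁻ X, ∑ i : Fin N, ∑ j ∈ Finset.univ.erase i,
        (shellPair a δ i j).indicator (fun Y => (‖Φ.ψ Y‖₊ : ℝ≥0∞) ^ 2) X =
      ∑ i : Fin N, ∑ j ∈ Finset.univ.erase i,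
        ∫⁻ X, (shellPair a δ i j).indicator (fun Y => (‖Φ.ψ Y‖₊ : ℝ≥0∞) ^ 2) X := by
  rw [lintegral_finsetSum _ fun i _ => Finset.measurable_sum _ fun j _ =>
    measurable_shell_indicator Φ a δ i j]
  exact Finset.sum_congr rfl fun i _ =>
    lintegral_finsetSum _ fun j _ => measurable_shell_indicator Φ a δ i j

/-! ### The pointwise bounds -/

section Pointwise

variable {v : ℝ → ℝ≥0∞} {b s : ℝ} {C A' : ℝ≥0} {m : ℕ} {θ : ℝ} {χ : Config N → ℝ}

/-- **Pointwise form bound for the core-cut state** `χΦ`: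
`|∇(χΦ)|² + V|χΦ|² ≤ (1+θ)(|∇Φ|² + (V ⊓ m)|Φ|²) + (1+θ⁻¹) A' ∑_{i} ∑_{j ≠ i} 1_{shell_{ij}} |Φ|²`
(IMS/Young multiplier bound; on `supp χ` all pairs are `> b`, where `v = v ⊓ m`; the gradient of
`χ` lives where some pair is in the shell). [cite: LSSY2005, proof of Thm 2.4] -/
theorem form_pt (Φ : TrialState N L) (hCm : (C : ℝ≥0∞) ≤ m) (hθ : 0 < θ)
    (hC : ∀ t : ℝ, b < t → v t ≤ C) (hχ : ContDiff ℝ 1 χ) (hχ01 : ∀ X, 0 ≤ χ X ∧ χ X ≤ 1)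
    (hχ0 : ∀ X : Config N, (∃ i j : Fin N, i ≠ j ∧ dist (X i) (X j) ≤ b) → χ X = 0)
    (hA : ∀ X : Config N, realKinetic χ X ≤
        {Y : Config N | ∃ i j : Fin N, i ≠ j ∧ b < dist (Y i) (Y j) ∧
            dist (Y i) (Y j) < b + 3 * s}.indicator (fun _ => (A' : ℝ≥0∞)) X) (X : Config N) :
    kineticDensity (fun Y => (χ Y : ℂ) * (Φ.ψ Y)) X +
        interaction v X * (‖(χ X : ℂ) * Φ.ψ X‖₊ : ℝ≥0∞) ^ 2 ≤
      ENNReal.ofReal (1 + θ) * (kineticDensity Φ.ψ X +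
          interaction (fun r => min (v r) (m : ℝ≥0∞)) X * (‖Φ.ψ X‖₊ : ℝ≥0∞) ^ 2) +
        ENNReal.ofReal (1 + θ⁻¹) * (A' : ℝ≥0∞) *
          ∑ i : Fin N, ∑ j ∈ Finset.univ.erase i,
            (shellPair b (3 * s) i j).indicator (fun Y => (‖Φ.ψ Y‖₊ : ℝ≥0∞) ^ 2) X := by
  -- adapted from `GroundStateRigidity.EnergyTrunc.form_pt_le`
  have hΦd : Differentiable ℝ Φ.ψ := Φ.contDiff.differentiable one_ne_zero
  have hχd : Differentiable ℝ χ := hχ.differentiable one_ne_zero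
  -- kinetic part
  have hkin := kineticDensity_ofReal_mul_le (hΦd X) (hχd X) hθ
  have hA1 : ENNReal.ofReal ((1 + θ) * χ X ^ 2) * kineticDensity Φ.ψ X ≤
      ENNReal.ofReal (1 + θ) * kineticDensity Φ.ψ X := by
    refine mul_le_mul' (ENNReal.ofReal_le_ofReal ?_) le_rfl
    have hχ2 : χ X ^ 2 ≤ 1 := by have := hχ01 X; nlinarith [this.1, this.2]
    nlinarith [hχ2]
  have hA2 : ENNReal.ofReal (1 + θ⁻¹) * (‖Φ.ψ X‖₊ : ℝ≥0∞) ^ 2 *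
        kineticDensity (fun Y => (χ Y : ℂ)) X ≤
      ENNReal.ofReal (1 + θ⁻¹) * (A' : ℝ≥0∞) *
          ∑ i : Fin N, ∑ j ∈ Finset.univ.erase i,
            (shellPair b (3 * s) i j).indicator (fun Y => (‖Φ.ψ Y‖₊ : ℝ≥0∞) ^ 2) X := by
    rw [kineticDensity_ofReal hχd X, mul_assoc, mul_assoc]
    refine mul_le_mul' le_rfl ?_
    have h1 := hA X
    by_cases hXT : X ∈ {Y : Config N | ∃ i j : Fin N, i ≠ j ∧ b < dist (Y i) (Y j) ∧
        dist (Y i) (Y j) < b + 3 * s}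
    · rw [indicator_of_mem hXT] at h1
      obtain ⟨i, j, hij, hb1, hb2⟩ := hXT
      calc (‖Φ.ψ X‖₊ : ℝ≥0∞) ^ 2 * realKinetic χ X
          ≤ (‖Φ.ψ X‖₊ : ℝ≥0∞) ^ 2 * (A' : ℝ≥0∞) := mul_le_mul' le_rfl h1
        _ = (A' : ℝ≥0∞) * (‖Φ.ψ X‖₊ : ℝ≥0∞) ^ 2 := mul_comm _ _
        _ ≤ _ := mul_le_mul' le_rfl
            (le_sum_shell (fun Y => (‖Φ.ψ Y‖₊ : ℝ≥0∞) ^ 2) hij ⟨hb1, hb2⟩)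
    · rw [indicator_of_notMem hXT, nonpos_iff_eq_zero] at h1
      rw [h1, mul_zero]
      exact zero_le
  -- potential part
  have hP : interaction v X * (‖(χ X : ℂ) * Φ.ψ X‖₊ : ℝ≥0∞) ^ 2 ≤
      ENNReal.ofReal (1 + θ) *
        (interaction (fun r => min (v r) (m : ℝ≥0∞)) X * (‖Φ.ψ X‖₊ : ℝ≥0∞) ^ 2) := by
    by_cases hχX : χ X = 0
    · simp [hχX]
    · have hfar : ∀ i j : Fin N, i ≠ j → b < dist (X i) (X j) := fun i j hij =>
        not_le.1 fun h => hχX (hχ0 X ⟨i, j, hij, h⟩)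
      rw [interaction_eq_trunc_of_lt hC hCm hfar]
      have hθ1 : (1 : ℝ≥0∞) ≤ ENNReal.ofReal (1 + θ) := by
        rw [← ENNReal.ofReal_one]; exact ENNReal.ofReal_le_ofReal (by linarith)
      have hle : (‖(χ X : ℂ) * Φ.ψ X‖₊ : ℝ≥0∞) ≤ ‖Φ.ψ X‖₊ :=
        ENNReal.coe_le_coe.2 (EnergyTrunc.nnnorm_cut_le hχ01 Φ.ψ X)
      calc _ ≤ interaction (fun r => min (v r) (m : ℝ≥0∞)) X * (‖Φ.ψ X‖₊ : ℝ≥0∞) ^ 2 :=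
            mul_le_mul' le_rfl (pow_le_pow_left' hle 2)
        _ = 1 * _ := (one_mul _).symm
        _ ≤ _ := mul_le_mul' hθ1 le_rfl
  calc _ ≤ (ENNReal.ofReal (1 + θ) * kineticDensity Φ.ψ X +
        ENNReal.ofReal (1 + θ⁻¹) * (A' : ℝ≥0∞) *
          ∑ i : Fin N, ∑ j ∈ Finset.univ.erase i,
            (shellPair b (3 * s) i j).indicator (fun Y => (‖Φ.ψ Y‖₊ : ℝ≥0∞) ^ 2) X) +
        ENNReal.ofReal (1 + θ) *
          (interaction (fun r => min (v r) (m : ℝ≥0∞)) X * (‖Φ.ψ X‖₊ : ℝ≥0∞) ^ 2) :=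
        add_le_add (hkin.trans (add_le_add hA1 hA2)) hP
    _ = _ := by ring

/-- **Pointwise mass bound**: `|Φ|² ≤ |χΦ|² + 1_{core}|Φ|² + ∑_{i} ∑_{j ≠ i} 1_{shell_{ij}} |Φ|²`
(where `χ = 1` the first term is `|Φ|²; elsewhere the covering `cover_pt`). [folklore] -/
theorem mass_pt (Φ : TrialState N L)
    (hχ1 : ∀ X : Config N, (∀ i j : Fin N, i ≠ j → b + 3 * s ≤ dist (X i) (X j)) → χ X = 1)
    (X : Config N) :
    (‖Φ.ψ X‖₊ : ℝ≥0∞) ^ 2 ≤ (‖(χ X : ℂ) * Φ.ψ X‖₊ : ℝ≥0∞) ^ 2 +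
      ({Y : Config N | ∃ i j : Fin N, i ≠ j ∧ dist (Y i) (Y j) ≤ b}.indicator
          (fun Y => (‖Φ.ψ Y‖₊ : ℝ≥0∞) ^ 2) X +
        ∑ i : Fin N, ∑ j ∈ Finset.univ.erase i,
          (shellPair b (3 * s) i j).indicator (fun Y => (‖Φ.ψ Y‖₊ : ℝ≥0∞) ^ 2) X) := by
  by_cases hX : χ X = 1
  · rw [hX, Complex.ofReal_one, one_mul]
    exact le_self_add
  · exact (cover_pt hχ1 (fun Y => (‖Φ.ψ Y‖₊ : ℝ≥0∞) ^ 2) hX).trans le_add_self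

/-- A `[0,1]`-valued real multiplier is `L∞`-close to `1` by at most `1`: `|χΦ − Φ| ≤ |Φ|`.
[folklore] -/
theorem nnnorm_cut_sub_le (hχ01 : ∀ X, 0 ≤ χ X ∧ χ X ≤ 1) (g : Config N → ℂ) (X : Config N) :
    ‖(χ X : ℂ) * g X - g X‖₊ ≤ ‖g X‖₊ := by
  have h1 : (χ X : ℂ) * g X - g X = ((χ X - 1 : ℝ) : ℂ) * g X := by push_cast; ring
  rw [h1, nnnorm_mul, ← NNReal.coe_le_coe, NNReal.coe_mul, coe_nnnorm, coe_nnnorm,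
    Complex.norm_real, Real.norm_eq_abs]
  refine mul_le_of_le_one_left (norm_nonneg _) (abs_le.2 ⟨?_, ?_⟩)
  · linarith [(hχ01 X).1]
  · linarith [(hχ01 X).2]

/-- **Pointwise distance bound**: `|χΦ − Φ|² ≤ 1_{core}|Φ|² + ∑_{i} ∑_{j ≠ i} 1_{shell_{ij}} |Φ|²`
(zero where `χ = 1`; elsewhere `|χΦ − Φ| ≤ |Φ|` and the covering `cover_pt`). [folklore] -/
theorem dist_pt (Φ : TrialState N L) (hχ01 : ∀ X, 0 ≤ χ X ∧ χ X ≤ 1)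
    (hχ1 : ∀ X : Config N, (∀ i j : Fin N, i ≠ j → b + 3 * s ≤ dist (X i) (X j)) → χ X = 1)
    (X : Config N) :
    (‖(χ X : ℂ) * Φ.ψ X - Φ.ψ X‖₊ : ℝ≥0∞) ^ 2 ≤
      {Y : Config N | ∃ i j : Fin N, i ≠ j ∧ dist (Y i) (Y j) ≤ b}.indicator
          (fun Y => (‖Φ.ψ Y‖₊ : ℝ≥0∞) ^ 2) X +
        ∑ i : Fin N, ∑ j ∈ Finset.univ.erase i,
          (shellPair b (3 * s) i j).indicator (fun Y => (‖Φ.ψ Y‖₊ : ℝ≥0∞) ^ 2) X := by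
  by_cases hX : χ X = 1
  · rw [hX, Complex.ofReal_one, one_mul, sub_self, nnnorm_zero, ENNReal.coe_zero,
      zero_pow two_ne_zero]
    exact zero_le
  · exact (pow_le_pow_left' (ENNReal.coe_le_coe.2 (nnnorm_cut_sub_le hχ01 Φ.ψ X)) 2).trans
      (cover_pt hχ1 (fun Y => (‖Φ.ψ Y‖₊ : ℝ≥0∞) ^ 2) hX)

end Pointwise

end CutState

/-- **Stub 15f — form, mass and distance bounds for the core-cut state `χ Φ` (hard-core class).**
With `v = ⊤` on `[0,b]`, `v ≤ C` beyond `b`, `m ≥ C`, a trial state `Φ`, and an outer cutoff `χ`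
(`= 0` where some pair is `≤ b`, `= 1` where all pairs are `≥ b + 3s`, gradient supported in
`{some pair ∈ (b, b+3s)}` and bounded by `A'` there): (i) `Q_v(χΦ) ≤ (1+θ) energy (v ⊓ m) Φ +
(1+θ⁻¹) A' ∑_{i≠j} ∫_{shell_{ij}(b,3s)} |Φ|²` (`kineticDensity_ofReal_mul_le`; on `supp χ` all pairs are
`> b`, where `v = v ⊓ m`); (ii) `1 ≤ ∫|χΦ|² + ∫_{some pair ≤ b}|Φ|² + ∑_{i≠j} ∫_{shell_{ij}(b,3s)}|Φ|²`;
(iii) `∫|χΦ − Φ|² ≤ ∫_{some pair ≤ b}|Φ|² + ∑_{i≠j} ∫_{shell_{ij}(b,3s)}|Φ|²` (where `χ < 1` some pair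
is `< b + 3s`). [cite: LSSY2005, proof of Thm 2.4] -/
theorem stub_cutStateBound :
    ∀ (N : ℕ) (L : ℝ) (v : ℝ → ℝ≥0∞) (b s : ℝ) (C A' : ℝ≥0) (m : ℕ) (θ : ℝ) (Φ : TrialState N L)
      (χ : Config N → ℝ), Measurable v → 0 < b → 0 < s → (C : ℝ) ≤ m → 0 < θ →
      (∀ t : ℝ, t ∈ Set.Icc 0 b → v t = ⊤) → (∀ t : ℝ, b < t → v t ≤ C) →
      ContDiff ℝ 1 χ → (∀ X, 0 ≤ χ X ∧ χ X ≤ 1) →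
      (∀ X : Config N, (∃ i j : Fin N, i ≠ j ∧ dist (X i) (X j) ≤ b) → χ X = 0) →
      (∀ X : Config N, (∀ i j : Fin N, i ≠ j → b + 3 * s ≤ dist (X i) (X j)) → χ X = 1) →
      (∀ X : Config N, realKinetic χ X ≤
        {Y : Config N | ∃ i j : Fin N, i ≠ j ∧ b < dist (Y i) (Y j) ∧
            dist (Y i) (Y j) < b + 3 * s}.indicator (fun _ => (A' : ℝ≥0∞)) X) →
      (∫⁻ X, kineticDensity (fun Y => (χ Y : ℂ) * (Φ.ψ Y)) X +
            interaction v X * (‖(χ X : ℂ) * Φ.ψ X‖₊ : ℝ≥0∞) ^ 2 ≤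
          ENNReal.ofReal (1 + θ) * energy (fun r => min (v r) (m : ℝ≥0∞)) Φ +
            ENNReal.ofReal (1 + θ⁻¹) * (A' : ℝ≥0∞) *
              ∑ i : Fin N, ∑ j ∈ Finset.univ.erase i,
                ∫⁻ X, (shellPair b (3 * s) i j).indicator (fun Y => (‖Φ.ψ Y‖₊ : ℝ≥0∞) ^ 2) X) ∧
        (1 ≤ (∫⁻ X, (‖(χ X : ℂ) * Φ.ψ X‖₊ : ℝ≥0∞) ^ 2) +
            ((∫⁻ X, {Y : Config N | ∃ i j : Fin N, i ≠ j ∧ dist (Y i) (Y j) ≤ b}.indicator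
                (fun Y => (‖Φ.ψ Y‖₊ : ℝ≥0∞) ^ 2) X) +
              ∑ i : Fin N, ∑ j ∈ Finset.univ.erase i,
                ∫⁻ X, (shellPair b (3 * s) i j).indicator (fun Y => (‖Φ.ψ Y‖₊ : ℝ≥0∞) ^ 2) X)) ∧
        (∫⁻ X, (‖(χ X : ℂ) * Φ.ψ X - Φ.ψ X‖₊ : ℝ≥0∞) ^ 2 ≤
            (∫⁻ X, {Y : Config N | ∃ i j : Fin N, i ≠ j ∧ dist (Y i) (Y j) ≤ b}.indicator
                (fun Y => (‖Φ.ψ Y‖₊ : ℝ≥0∞) ^ 2) X) +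
              ∑ i : Fin N, ∑ j ∈ Finset.univ.erase i,
                ∫⁻ X, (shellPair b (3 * s) i j).indicator (fun Y => (‖Φ.ψ Y‖₊ : ℝ≥0∞) ^ 2) X) := by
  intro N L v b s C A' m θ Φ χ hv _hb _hs hCm hθ _hcore hC hχ hχ01 hχ0 hχ1 hA
  have hCm' : (C : ℝ≥0∞) ≤ m := by
    rw [← ENNReal.ofReal_coe_nnreal, ← ENNReal.ofReal_natCast]
    exact ENNReal.ofReal_le_ofReal hCm
  have hmc : Measurable fun X => (‖(χ X : ℂ) * Φ.ψ X‖₊ : ℝ≥0∞) ^ 2 :=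
    measurable_normSq ((Complex.continuous_ofReal.comp hχ.continuous).mul Φ.contDiff.continuous)
  have hsum := CutState.lintegral_sum_shell Φ b (3 * s)
  refine ⟨?_, ?_, ?_⟩
  · -- (i) form bound
    have hmeas : Measurable fun X => ENNReal.ofReal (1 + θ) * (kineticDensity Φ.ψ X +
        interaction (fun r => min (v r) (m : ℝ≥0∞)) X * (‖Φ.ψ X‖₊ : ℝ≥0∞) ^ 2) :=
      measurable_const.mul ((measurable_kineticDensity Φ.contDiff).add
        ((measurable_interaction (hv.min measurable_const)).mul
          (measurable_normSq Φ.contDiff.continuous)))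
    calc _ ≤ ∫⁻ X, ENNReal.ofReal (1 + θ) * (kineticDensity Φ.ψ X +
            interaction (fun r => min (v r) (m : ℝ≥0∞)) X * (‖Φ.ψ X‖₊ : ℝ≥0∞) ^ 2) +
          ENNReal.ofReal (1 + θ⁻¹) * (A' : ℝ≥0∞) *
            ∑ i : Fin N, ∑ j ∈ Finset.univ.erase i,
              (shellPair b (3 * s) i j).indicator (fun Y => (‖Φ.ψ Y‖₊ : ℝ≥0∞) ^ 2) X :=
          lintegral_mono fun X => CutState.form_pt Φ hCm' hθ hC hχ hχ01 hχ0 hA X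
      _ = _ := by
          rw [lintegral_add_left hmeas, lintegral_const_mul' _ _ ENNReal.ofReal_ne_top,
            lintegral_const_mul' _ _ (ENNReal.mul_ne_top ENNReal.ofReal_ne_top ENNReal.coe_ne_top),
            hsum]
          rfl
  · -- (ii) mass bound
    calc (1 : ℝ≥0∞) = ∫⁻ X, (‖Φ.ψ X‖₊ : ℝ≥0∞) ^ 2 := Φ.norm_eq.symm
      _ ≤ ∫⁻ X, (‖(χ X : ℂ) * Φ.ψ X‖₊ : ℝ≥0∞) ^ 2 +
          ({Y : Config N | ∃ i j : Fin N, i ≠ j ∧ dist (Y i) (Y j) ≤ b}.indicator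
              (fun Y => (‖Φ.ψ Y‖₊ : ℝ≥0∞) ^ 2) X +
            ∑ i : Fin N, ∑ j ∈ Finset.univ.erase i,
              (shellPair b (3 * s) i j).indicator (fun Y => (‖Φ.ψ Y‖₊ : ℝ≥0∞) ^ 2) X) :=
          lintegral_mono fun X => CutState.mass_pt Φ hχ1 X
      _ = _ := by
          rw [lintegral_add_left hmc, lintegral_add_right _ (CutState.measurable_sum_shell Φ _ _),
            hsum]
  · -- (iii) distance bound
    calc _ ≤ ∫⁻ X, {Y : Config N | ∃ i j : Fin N, i ≠ j ∧ dist (Y i) (Y j) ≤ b}.indicator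
              (fun Y => (‖Φ.ψ Y‖₊ : ℝ≥0∞) ^ 2) X +
            ∑ i : Fin N, ∑ j ∈ Finset.univ.erase i,
              (shellPair b (3 * s) i j).indicator (fun Y => (‖Φ.ψ Y‖₊ : ℝ≥0∞) ^ 2) X :=
          lintegral_mono fun X => CutState.dist_pt Φ hχ01 hχ1 X
      _ = _ := by
          rw [lintegral_add_right _ (CutState.measurable_sum_shell Φ _ _), hsum]

end Summit.AtomisticToContinuum.BoseEinsteinCondensation.Theorems.GroundStateRigidity

end
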